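import Literature.Probability.Percolation.BockEtAl2020Numerics
import Literature.Probability.Percolation.FiniteClustersPercolationProofs
import HarnessLib

/-!
# BDNS Corollary 1.5 (`BockEtAl2020_Cor_1_5`) split at the large dimensions `d ≥ 40`

Topic `Literature/Probability/Percolation`. SPLIT RECORD (fact-decompose, 2026-08-16) of the named
fact `Literature.Probability.Percolation.BockEtAl2020_Cor_1_5` (`FiniteClustersPercolation.lean`;
B. Bock, M. Damron, C. M. Newman, V. Sidoravicius, *Percolation of finite clusters and shielded
paths*, J. Stat. Phys. 179 (2020) 789–807 = arXiv:1811.01678, Cor. 1.5: "For `d ≥ 10`,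
`p_c(d) < p_shield(d) ≤ p_fin(d)`").

State of the tree: the second inequality (1.4) is PROVED for every `d` (`pShield_le_pFin`,
`FiniteClustersPercolationProofs.lean`), so the corollary is reduced to its first inequality
(`BockEtAl2020_Cor_1_5_of_criticalProb_lt_pShield`); the first inequality is reduced to closed
numerical inequalities exactly as in the printed proof of §4 (Thm 1.2 + Lemma 3.1 + Lemma 4.1 +
the Cox–Durrett bound `p_c(d) ≤ ρ_d ≤ g(d)`, `criticalProb_lt_pShield_of_numerics`,
`CriticalProbLtPShield.lean`) and DISCHARGED by certified rational witnesses for `10 ≤ d < 40`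
(`criticalProb_lt_pShield_of_lt_forty`, `BockEtAl2020Numerics.lean`, the formal counterpart of the
source's Table 1). The source settles ALL `d ≥ 10` by that table — "Table 1 shows computed values
of the left sides of these inequalities. Their values drop below 1 between dimensions 9 and 10"
(§4, end of the proof of Cor. 1.5) — i.e. by the numerics for the displayed rows and, implicitly,
by the decay of both left sides in `d` (`g(d) ∼ 1/d`; cf. the short asymptotic proof of §2,
`p_shield(d)/p_c(d) → ∞`). What is not in the tree is the analytic verification of the two
inequalities (4.12)–(4.13) for all `d ≥ 40` (the file `BockEtAl2020LargeD.lean` announced in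
`BockEtAl2020Numerics.lean` never landed: the seat hit its budget cap). This file vendors exactly
that as the named fact `BockEtAl2020_criticalProb_lt_pShield_of_forty_le` and PROVES the assembly
`BockEtAl2020_Cor_1_5_holds_of`.

The child does not restate the parent: it is the first inequality only, and only for `d ≥ 40`.
Two roads to its discharge: (i) `criticalProb_lt_pShield_of_numerics` with witnesses given as
closed expressions in `d` (e.g. `g = 3/(2d)`, `p̂ = 2/d`, bounding `rhoHead d + rhoMid d + T(d)`
and `retHead d + retMid d + d·T(d)` by elementary estimates of the factorial sums for `d ≥ 40`);
(ii) the asymptotic argument of §2 made effective.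

DISCHARGE (appended 2026-08-20, road (i)): section `BDNSLargeD` below proves, for every `d ≥ 40`, the
fourteen hypotheses of `criticalProb_lt_pShield_of_numerics` with the witnesses
`T = (49/24)·(1/2)^⌊d/2⌋` (from `d!/d^d ≤ (1/2)^⌊d/2⌋`, `(2d)!/(2^d d^{2d}) ≤ d!/d^d` and the Stirling test
`7.3891 d/6.283184^d ≤ ((1/2)^⌊d/2⌋)²`), `g = rhoHead d + rhoMid d + T`, `p̂ = 1/d + 2/d²`,
`ρ = retHead d + retMid d + d T`, `r = 1 - (1-ρ)/(d²ρ - d) - 1/d²`, `V_S = 2`, `V_0 = 4`, using the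
elementary bounds `retMid d ≤ 120/d⁵ + 5760/d⁶` (`k!/d^k ≤ 7!/d⁷` for `7 ≤ k ≤ d`),
`rhoMid d = retMid d / d`, `(1/2)^⌊d/2⌋ ≤ 1/(8d³)`, `(1 - p̂)⁻¹ ≤ 1 + 1.08/d`,
`(1 - p̂)^{-(2d-1)} ≤ exp(2.16) ≤ 9`, `r ≤ 0.29`; whence
`BockEtAl2020_criticalProb_lt_pShield_of_forty_le_holds` and, with the certified table for
`10 ≤ d < 40`, `BockEtAl2020_Cor_1_5_holds : BockEtAl2020_Cor_1_5` (BDNS Cor. 1.5 for every `d ≥ 10`,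
unconditional).  The constants were designed and checked in exact rational arithmetic for
`d = 40, …, 399` before formalisation; every inequality below is proved symbolically for all `d ≥ 40`.

## References

* B. Bock, M. Damron, C. M. Newman, V. Sidoravicius, J. Stat. Phys. 179 (2020) 789–807 =
  arXiv:1811.01678: Cor. 1.5 and its proof (§4, (4.12)–(4.13), Table 1), Thm 1.2, Lemma 3.1,
  Lemma 4.1, §2. [BockEtAl2020]
-/

noncomputable section

namespace Literature.Probability.Percolation

open Literature.Probability.LatticeModels

/-- **BDNS Cor. 1.5, first inequality, in the large dimensions: `p_c(d) < p_shield(d)` for all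
`d ≥ 40`** (bond percolation on `ℤ^d`; `p_c = criticalProb (zdGraph d) 0`, `p_shield = pShield d`,
(1.3)). Printed proof (§4): for `p = g(d)` (the explicit Cox–Durrett-type upper bound (4.11) for
`p_c(d) ≤ ρ_d`) the two conditions of Thm 1.2 hold in the form (4.12)
`g(d)(1 - d^{-1/(2d-1)})⁻¹ < 1` and (4.13)
`(1-g(d))⁻¹ (t(B(d)) - d⁻² + d⁻¹(1-d⁻¹)(d(1-g(d))^{2d-1} - 1)⁻¹) < 1`, "For any `d` such that these
inequalities hold, we must have `p_shield(d) > p_c(d)`", and "Table 1 shows computed values of the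
left sides of these inequalities. Their values drop below 1 between dimensions 9 and 10" — the rows
`10 ≤ d < 40` being certified in the tree (`criticalProb_lt_pShield_of_lt_forty`), this is the
remaining range, where both left sides keep decreasing (`g(d), B(d) = 1/d + O(d⁻²)`). DISCHARGED
below (`BockEtAl2020_criticalProb_lt_pShield_of_forty_le_holds`, 2026-08-20) by uniform-in-`d`
witnesses for `criticalProb_lt_pShield_of_numerics` (section `BDNSLargeD`).
[cite: BockEtAl2020, Cor 1.5 and §4 (proof: (4.11)–(4.13), Table 1)] -/
def BockEtAl2020_criticalProb_lt_pShield_of_forty_le : Prop :=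
  ∀ d : ℕ, 40 ≤ d → criticalProb (zdGraph d) 0 < pShield d

/-- **Assembly of the split: BDNS Cor. 1.5 from its large-`d` child.** For `10 ≤ d < 40` the
first inequality is the tree's certified table `criticalProb_lt_pShield_of_lt_forty`, for `d ≥ 40`
it is the child; the second inequality `p_shield ≤ p_fin` is `pShield_le_pFin`
(`BockEtAl2020_Cor_1_5_of_criticalProb_lt_pShield`). [cite: BockEtAl2020, Cor 1.5 and (1.4)] -/
theorem BockEtAl2020_Cor_1_5_holds_of (h : BockEtAl2020_criticalProb_lt_pShield_of_forty_le) :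
    BockEtAl2020_Cor_1_5 :=
  BockEtAl2020_Cor_1_5_of_criticalProb_lt_pShield fun d hd =>
    if h40 : d < 40 then criticalProb_lt_pShield_of_lt_forty hd h40 else h d (by omega)

/-! ## Discharge for `d ≥ 40` (road (i)): uniform witnesses for `criticalProb_lt_pShield_of_numerics`

All statements in this section are steps of the verification of (4.12)–(4.13) for `d ≥ 40`
[cite: BockEtAl2020, §4 (proof of Cor 1.5)]; the purely arithmetical helper lemmas are `private`. -/

open Finset
open scoped Nat

namespace BDNSLargeD

/-! ### Elementary factorial estimates -/

/-- `(n + m)! ≤ n! (n + m)^m`. [folklore] -/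
private theorem factorial_add_le (n m : ℕ) : (n + m) ! ≤ n ! * (n + m) ^ m := by
  rw [← Nat.factorial_mul_ascFactorial n m]
  exact Nat.mul_le_mul_left _ (Nat.ascFactorial_le_pow_add n m)

/-- `d!/d^d ≤ (1/2)^⌊d/2⌋`. [cite: BockEtAl2020, §4 (proof of Cor 1.5, (4.11)–(4.13))] -/
theorem factorial_div_pow_le_half_pow {d : ℕ} (hd : 1 ≤ d) :
    (d ! : ℝ) / (d : ℝ) ^ d ≤ (1 / 2 : ℝ) ^ (d / 2) := by
  set h := d / 2 with hh
  obtain ⟨m, hdm⟩ : ∃ m, h + m = d := ⟨d - h, by omega⟩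
  have key : d ! ≤ h ^ h * d ^ m := by
    have := (factorial_add_le h m).trans (Nat.mul_le_mul_right _ (Nat.factorial_le_pow h))
    rw [hdm] at this
    simpa [mul_comm] using this
  have hd0 : (0 : ℝ) < d := by exact_mod_cast hd
  have key' : (d ! : ℝ) ≤ (h : ℝ) ^ h * (d : ℝ) ^ m := by exact_mod_cast key
  have h2 : (h : ℝ) ≤ 1 / 2 * d := by
    have : 2 * h ≤ d := Nat.mul_div_le d 2
    have : (2 : ℝ) * h ≤ d := by exact_mod_cast this
    linarith
  rw [div_le_iff₀ (by positivity)]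
  calc (d ! : ℝ) ≤ (h : ℝ) ^ h * (d : ℝ) ^ m := key'
    _ ≤ (1 / 2 * d) ^ h * (d : ℝ) ^ m :=
        mul_le_mul_of_nonneg_right (pow_le_pow_left₀ (by positivity) h2 h) (by positivity)
    _ = (1 / 2 : ℝ) ^ (d / 2) * (d : ℝ) ^ d := by
        rw [mul_pow, ← hh, mul_assoc, ← pow_add, hdm]

/-- `(2d)!/(2^d d^{2d}) ≤ d!/d^d`. [cite: BockEtAl2020, §4 (proof of Cor 1.5, (4.11)–(4.13))] -/
theorem balancedTerm_two_le_factorial_div {d : ℕ} (hd : 1 ≤ d) :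
    ((2 * d) ! : ℝ) / ((2 : ℝ) ^ d * (d : ℝ) ^ (2 * d)) ≤ (d ! : ℝ) / (d : ℝ) ^ d := by
  have hd0 : (0 : ℝ) < d := by exact_mod_cast hd
  have key : (2 * d) ! ≤ d ! * (2 * d) ^ d := by
    have := factorial_add_le d d
    rwa [← two_mul] at this
  have key' : ((2 * d) ! : ℝ) ≤ (d ! : ℝ) * ((2 : ℝ) * d) ^ d := by exact_mod_cast key
  rw [div_le_div_iff₀ (by positivity) (by positivity)]
  calc ((2 * d) ! : ℝ) * (d : ℝ) ^ d ≤ (d ! : ℝ) * ((2 : ℝ) * d) ^ d * (d : ℝ) ^ d :=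
        mul_le_mul_of_nonneg_right key' (by positivity)
    _ = (d ! : ℝ) * ((2 : ℝ) ^ d * (d : ℝ) ^ (2 * d)) := by
        rw [mul_pow, two_mul, pow_add]; ring

/-- `8 n ≤ 3^n` for `n ≥ 4`. [folklore] -/
private theorem eight_mul_le_three_pow {n : ℕ} (hn : 4 ≤ n) : 8 * n ≤ 3 ^ n := by
  induction n, hn using Nat.le_induction with
  | base => norm_num
  | succ k hk ih =>
    have h3 : 1 ≤ 3 ^ k := Nat.one_le_pow _ _ (by norm_num)
    calc 8 * (k + 1) = 8 * k + 8 := by ring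
      _ ≤ 3 ^ k + 8 := by omega
      _ ≤ 3 ^ k * 3 := by
          have : 8 ≤ 2 * 3 ^ k := by
            have : 3 ^ 4 ≤ 3 ^ k := Nat.pow_le_pow_right (by norm_num) hk
            omega
          omega
      _ = 3 ^ (k + 1) := by rw [pow_succ]

/-- The Stirling test for `s = (1/2)^⌊d/2⌋`: `7.3891 d/(2π)^d ≤ ((1/2)^⌊d/2⌋)²` for `d ≥ 4`. [cite: BockEtAl2020, §4 (proof of Cor 1.5, (4.11)–(4.13))] -/
theorem stirling_test_half_pow {d : ℕ} (hd : 4 ≤ d) :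
    (7.3891 : ℝ) * d / (6.283184 : ℝ) ^ d ≤ ((1 / 2 : ℝ) ^ (d / 2)) ^ 2 := by
  have hd0 : (0 : ℝ) < d := by exact_mod_cast (show 0 < d by omega)
  -- `((1/2)^⌊d/2⌋)² ≥ (1/2)^d`
  have h1 : (1 / 2 : ℝ) ^ d ≤ ((1 / 2 : ℝ) ^ (d / 2)) ^ 2 := by
    rw [← pow_mul]
    exact pow_le_pow_of_le_one (by norm_num) (by norm_num) (by omega)
  refine le_trans ?_ h1
  -- `7.3891 d ≤ 3^d ≤ 3.141592^d`
  have h3 : (8 : ℝ) * d ≤ (3 : ℝ) ^ d := by exact_mod_cast eight_mul_le_three_pow hd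
  have h4 : (3 : ℝ) ^ d ≤ (3.141592 : ℝ) ^ d := pow_le_pow_left₀ (by norm_num) (by norm_num) d
  have h6 : (1 / 2 : ℝ) ^ d = (3.141592 : ℝ) ^ d / (6.283184 : ℝ) ^ d := by
    rw [← div_pow]; norm_num
  rw [h6]
  exact div_le_div_of_nonneg_right (by nlinarith [h3, h4, hd0]) (by positivity)

/-- `8 (2k+1)³ ≤ 2^k` for `k ≥ 20`. [folklore] -/
private theorem eight_mul_cube_le_two_pow {k : ℕ} (hk : 20 ≤ k) : 8 * (2 * k + 1) ^ 3 ≤ 2 ^ k := by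
  induction k, hk using Nat.le_induction with
  | base => norm_num
  | succ k hk ih =>
    have h1 : 20 * k ^ 2 ≤ k ^ 3 := by
      calc 20 * k ^ 2 ≤ k * k ^ 2 := Nat.mul_le_mul_right _ hk
        _ = k ^ 3 := by ring
    have h2 : 20 * k ≤ k ^ 2 := by
      calc 20 * k ≤ k * k := Nat.mul_le_mul_right _ hk
        _ = k ^ 2 := by ring
    have h3 : (2 * (k + 1) + 1) ^ 3 ≤ 2 * (2 * k + 1) ^ 3 := by
      ring_nf
      nlinarith [h1, h2]
    calc 8 * (2 * (k + 1) + 1) ^ 3 ≤ 8 * (2 * (2 * k + 1) ^ 3) := Nat.mul_le_mul_left _ h3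
      _ = 2 * (8 * (2 * k + 1) ^ 3) := by ring
      _ ≤ 2 * 2 ^ k := Nat.mul_le_mul_left _ ih
      _ = 2 ^ (k + 1) := by rw [pow_succ]; ring

/-- `8 d³ ≤ 2^⌊d/2⌋` for `d ≥ 40`. [folklore] -/
private theorem eight_mul_cube_le_two_pow_half {d : ℕ} (hd : 40 ≤ d) : 8 * d ^ 3 ≤ 2 ^ (d / 2) := by
  have hk : 20 ≤ d / 2 := by omega
  have hd' : d ≤ 2 * (d / 2) + 1 := by omega
  calc 8 * d ^ 3 ≤ 8 * (2 * (d / 2) + 1) ^ 3 :=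
        Nat.mul_le_mul_left _ (Nat.pow_le_pow_left hd' 3)
    _ ≤ 2 ^ (d / 2) := eight_mul_cube_le_two_pow hk

/-- `(1/2)^⌊d/2⌋ ≤ 1/(8 d³)` for `d ≥ 40`. [cite: BockEtAl2020, §4 (proof of Cor 1.5, (4.11)–(4.13))] -/
theorem half_pow_le {d : ℕ} (hd : 40 ≤ d) : (1 / 2 : ℝ) ^ (d / 2) ≤ 1 / (8 * (d : ℝ) ^ 3) := by
  have hd0 : (0 : ℝ) < d := by exact_mod_cast (show 0 < d by omega)
  have key : (8 : ℝ) * (d : ℝ) ^ 3 ≤ (2 : ℝ) ^ (d / 2) := by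
    exact_mod_cast eight_mul_cube_le_two_pow_half hd
  rw [one_div_pow]
  exact one_div_le_one_div_of_le (by positivity) key


/-! ### The middle sums `retMid`, `rhoMid` -/

/-- `k!/d^k ≤ 7!/d^7` for `7 ≤ k ≤ d`. [cite: BockEtAl2020, §4 (proof of Cor 1.5, (4.11)–(4.13))] -/
theorem factorial_div_pow_le_seven {d : ℕ} (hd : 7 ≤ d) {k : ℕ} (hk : 7 ≤ k) (hkd : k ≤ d) :
    (k ! : ℝ) / (d : ℝ) ^ k ≤ 5040 / (d : ℝ) ^ 7 := by
  induction k, hk using Nat.le_induction with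
  | base => norm_num [Nat.factorial]
  | succ k hk ih =>
    have hd0 : (0 : ℝ) < d := by exact_mod_cast (show 0 < d by omega)
    have ih' := ih (by omega)
    have hk1 : ((k + 1 : ℕ) : ℝ) ≤ d := by exact_mod_cast hkd
    calc ((k + 1) ! : ℝ) / (d : ℝ) ^ (k + 1)
        = ((k + 1 : ℕ) : ℝ) / d * ((k ! : ℝ) / (d : ℝ) ^ k) := by
          rw [Nat.factorial_succ, pow_succ, div_mul_div_comm]
          push_cast
          ring
      _ ≤ 1 * ((k ! : ℝ) / (d : ℝ) ^ k) := by
          refine mul_le_mul_of_nonneg_right ?_ (by positivity)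
          rwa [div_le_one hd0]
      _ ≤ 5040 / (d : ℝ) ^ 7 := by rw [one_mul]; exact ih'

/-- `retMid d ≤ 120/d⁵ + 5760/d⁶` for `d ≥ 7`. [cite: BockEtAl2020, §4 (proof of Cor 1.5, (4.11)–(4.13))] -/
theorem retMid_le {d : ℕ} (hd : 7 ≤ d) :
    retMid d ≤ 120 * (1 / (d : ℝ) ^ 5) + 5760 * (1 / (d : ℝ) ^ 6) := by
  have hd0 : (0 : ℝ) < d := by exact_mod_cast (show 0 < d by omega)
  have hsplit : Finset.Ico 5 (d + 1) = insert 5 (insert 6 (Finset.Ico 7 (d + 1))) := by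
    ext k
    simp only [Finset.mem_Ico, Finset.mem_insert]
    omega
  unfold retMid
  rw [hsplit, Finset.sum_insert (by simp), Finset.sum_insert (by simp)]
  have h5 : ((5 : ℕ) ! : ℝ) / (d : ℝ) ^ 5 = 120 * (1 / (d : ℝ) ^ 5) := by
    norm_num [Nat.factorial]; ring
  have h6 : ((6 : ℕ) ! : ℝ) / (d : ℝ) ^ 6 = 720 * (1 / (d : ℝ) ^ 6) := by
    norm_num [Nat.factorial]; ring
  have hrest : ∑ k ∈ Finset.Ico 7 (d + 1), (k ! : ℝ) / (d : ℝ) ^ k ≤ 5040 * (1 / (d : ℝ) ^ 6) := by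
    calc ∑ k ∈ Finset.Ico 7 (d + 1), (k ! : ℝ) / (d : ℝ) ^ k
        ≤ ∑ k ∈ Finset.Ico 7 (d + 1), (5040 : ℝ) / (d : ℝ) ^ 7 :=
          Finset.sum_le_sum fun k hk => by
            rw [Finset.mem_Ico] at hk
            exact factorial_div_pow_le_seven hd hk.1 (by omega)
      _ = ((d + 1 - 7 : ℕ) : ℝ) * (5040 / (d : ℝ) ^ 7) := by
          rw [Finset.sum_const, Nat.card_Ico, nsmul_eq_mul]
      _ ≤ (d : ℝ) * (5040 / (d : ℝ) ^ 7) := by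
          refine mul_le_mul_of_nonneg_right ?_ (by positivity)
          exact_mod_cast (show d + 1 - 7 ≤ d by omega)
      _ = 5040 * (1 / (d : ℝ) ^ 6) := by
          field_simp
  rw [h5, h6]
  linarith

/-- `rhoMid d = retMid d / d`. [cite: BockEtAl2020, §4 (proof of Cor 1.5, (4.11)–(4.13))] -/
theorem rhoMid_eq_retMid_div (d : ℕ) : rhoMid d = retMid d / d := by
  unfold rhoMid retMid
  rw [Finset.sum_div]
  refine Finset.sum_congr rfl fun k _ => ?_
  rw [pow_succ, div_div]

/-! ### Bounds for `d ≥ 40` -/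

/-- For `D ≥ 40`, `0 ≤ a ≤ c ≤ e · 40ⁿ`: `a / D^(n+3) ≤ e · (1 / D³)`. [folklore] -/
private theorem div_pow_le {D a c e : ℝ} (hD : 40 ≤ D) (ha : 0 ≤ a) (hac : a ≤ c) (n : ℕ)
    (he : c ≤ e * 40 ^ n) : a / D ^ (n + 3) ≤ e * (1 / D ^ 3) := by
  have hD0 : 0 < D := by linarith
  have h40 : (40 : ℝ) ^ n ≤ D ^ n := pow_le_pow_left₀ (by norm_num) hD n
  have he0 : 0 ≤ e :=
    le_of_mul_le_mul_right (by rw [zero_mul]; exact ha.trans (hac.trans he)) (by positivity)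
  rw [mul_one_div, pow_add, div_le_div_iff₀ (by positivity) (by positivity)]
  calc a * D ^ 3 ≤ (e * 40 ^ n) * D ^ 3 :=
        mul_le_mul_of_nonneg_right (hac.trans he) (by positivity)
    _ ≤ (e * D ^ n) * D ^ 3 :=
        mul_le_mul_of_nonneg_right (mul_le_mul_of_nonneg_left h40 he0) (by positivity)
    _ = e * (D ^ n * D ^ 3) := by ring

/-- `exp 2.16 ≤ 9`. [folklore] -/
private theorem exp_216_le : Real.exp 2.16 ≤ 9 := by
  have e1 := Real.exp_one_lt_d9
  have e2 : Real.exp 0.16 ≤ 1 / (1 - 0.16) :=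
    Real.exp_bound_div_one_sub_of_interval (by norm_num) (by norm_num)
  have e0 : 0 < Real.exp 1 := Real.exp_pos 1
  have h : Real.exp 2.16 = Real.exp 1 * Real.exp 1 * Real.exp 0.16 := by
    rw [← Real.exp_add, ← Real.exp_add]; norm_num
  rw [h]
  have e3 : Real.exp 1 * Real.exp 1 ≤ 2.7182818286 * 2.7182818286 :=
    mul_le_mul e1.le e1.le e0.le (by norm_num)
  calc Real.exp 1 * Real.exp 1 * Real.exp 0.16
      ≤ (2.7182818286 * 2.7182818286) * (1 / (1 - 0.16)) :=
        mul_le_mul e3 e2 (Real.exp_pos _).le (by norm_num)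
    _ ≤ 9 := by norm_num

section Forty

variable {d : ℕ} (hd : 40 ≤ d)
include hd

/-- `40 ≤ d` in `ℝ`. [folklore] -/
private theorem D_ge : (40 : ℝ) ≤ d := by exact_mod_cast hd

/-- `0 < d` in `ℝ`. [folklore] -/
private theorem D_pos : (0 : ℝ) < d := by have := D_ge hd; linarith

/-- `rhoHead d ≤ 1/d + 1.09/d³`. [cite: BockEtAl2020, §4 (proof of Cor 1.5, (4.11)–(4.13))] -/
theorem rhoHead_le : rhoHead d ≤ 1 / (d : ℝ) + 1.09 * (1 / (d : ℝ) ^ 3) := by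
  have hD := D_ge hd
  have hD0 := D_pos hd
  have hi : 0 ≤ 1 / (d : ℝ) := by positivity
  have hi1 : 1 / (d : ℝ) ≤ 1 := by rw [div_le_one hD0]; linarith
  have t1 : (1 - 1 / (d : ℝ)) / (d : ℝ) ^ 3 ≤ 1 * (1 / (d : ℝ) ^ 3) :=
    div_pow_le hD (c := 1) (by linarith) (by linarith) 0 (by norm_num)
  have t2 : 3 * (1 - 1 / (d : ℝ)) / (d : ℝ) ^ 4 ≤ 0.075 * (1 / (d : ℝ) ^ 3) :=
    div_pow_le hD (c := 3) (by nlinarith) (by nlinarith) 1 (by norm_num)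
  have t3 : (1 - 1 / (d : ℝ)) * (14 - 1 / (d : ℝ)) / (d : ℝ) ^ 5 ≤ 0.00875 * (1 / (d : ℝ) ^ 3) :=
    div_pow_le hD (c := 14) (by nlinarith) (by nlinarith) 2 (by norm_num)
  unfold rhoHead
  have h3 : 0 ≤ 1 / (d : ℝ) ^ 3 := by positivity
  linarith

/-- `retHead d ≤ 1/d + 1/d² + 3.325/d³`. [cite: BockEtAl2020, §4 (proof of Cor 1.5, (4.11)–(4.13))] -/
theorem retHead_le :
    retHead d ≤ 1 / (d : ℝ) + 1 * (1 / (d : ℝ) ^ 2) + 3.325 * (1 / (d : ℝ) ^ 3) := by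
  have hD := D_ge hd
  have hD0 := D_pos hd
  have hi : 0 ≤ 1 / (d : ℝ) := by positivity
  have hi1 : 1 / (d : ℝ) ≤ 1 := by rw [div_le_one hD0]; linarith
  have t1 : (1 - 1 / (d : ℝ)) / (d : ℝ) ^ 2 ≤ 1 * (1 / (d : ℝ) ^ 2) := by
    rw [mul_one_div]
    exact div_le_div_of_nonneg_right (by linarith) (by positivity)
  have t2 : 3 * (1 - 1 / (d : ℝ)) / (d : ℝ) ^ 3 ≤ 3 * (1 / (d : ℝ) ^ 3) :=
    div_pow_le hD (c := 3) (by nlinarith) (by nlinarith) 0 (by norm_num)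
  have t3 : 13 * (1 - 1 / (d : ℝ)) / (d : ℝ) ^ 4 ≤ 0.325 * (1 / (d : ℝ) ^ 3) :=
    div_pow_le hD (c := 13) (by nlinarith) (by nlinarith) 1 (by norm_num)
  unfold retHead
  linarith

/-- `1/d + 0.975/d² ≤ retHead d`. [cite: BockEtAl2020, §4 (proof of Cor 1.5, (4.11)–(4.13))] -/
theorem retHead_ge : 1 / (d : ℝ) + 0.975 * (1 / (d : ℝ) ^ 2) ≤ retHead d := by
  have hD := D_ge hd
  have hD0 := D_pos hd
  have hi : 0 ≤ 1 / (d : ℝ) := by positivity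
  have hi40 : 1 / (d : ℝ) ≤ 1 / 40 := one_div_le_one_div_of_le (by norm_num) hD
  have t1 : 0.975 * (1 / (d : ℝ) ^ 2) ≤ (1 - 1 / (d : ℝ)) / (d : ℝ) ^ 2 := by
    rw [div_eq_mul_one_div (1 - 1 / (d : ℝ))]
    exact mul_le_mul_of_nonneg_right (by linarith) (by positivity)
  have t2 : 0 ≤ 3 * (1 - 1 / (d : ℝ)) / (d : ℝ) ^ 3 := by
    apply div_nonneg (by linarith) (by positivity)
  have t3 : 0 ≤ 13 * (1 - 1 / (d : ℝ)) / (d : ℝ) ^ 4 := by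
    apply div_nonneg (by linarith) (by positivity)
  unfold retHead
  linarith

/-- `retMid d ≤ 0.165/d³`. [cite: BockEtAl2020, §4 (proof of Cor 1.5, (4.11)–(4.13))] -/
theorem retMid_le' : retMid d ≤ 0.165 * (1 / (d : ℝ) ^ 3) := by
  have hD := D_ge hd
  have t1 : 120 * (1 / (d : ℝ) ^ 5) ≤ 0.075 * (1 / (d : ℝ) ^ 3) := by
    rw [mul_one_div]
    exact div_pow_le hD (c := 120) (by norm_num) le_rfl 2 (by norm_num)
  have t2 : 5760 * (1 / (d : ℝ) ^ 6) ≤ 0.09 * (1 / (d : ℝ) ^ 3) := by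
    rw [mul_one_div]
    exact div_pow_le hD (c := 5760) (by norm_num) le_rfl 3 (by norm_num)
  have := retMid_le (d := d) (by omega)
  linarith

/-- `rhoMid d ≤ 0.005/d³`. [cite: BockEtAl2020, §4 (proof of Cor 1.5, (4.11)–(4.13))] -/
theorem rhoMid_le' : rhoMid d ≤ 0.005 * (1 / (d : ℝ) ^ 3) := by
  have hD := D_ge hd
  have hD0 := D_pos hd
  rw [rhoMid_eq_retMid_div]
  have h1 : retMid d / d ≤ 0.165 * (1 / (d : ℝ) ^ 3) / d :=
    div_le_div_of_nonneg_right (retMid_le' hd) hD0.le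
  refine h1.trans ?_
  have e : 0.165 * (1 / (d : ℝ) ^ 3) / d = 0.165 / (d : ℝ) ^ 4 := by
    field_simp
  rw [e]
  exact div_pow_le hD (c := 0.165) (by norm_num) le_rfl 1 (by norm_num)

/-- The tail witness `T = (49/24)(1/2)^⌊d/2⌋` bounds the Stirling tail. [cite: BockEtAl2020, §4 (proof of Cor 1.5, (4.11)–(4.13))] -/
theorem sum_balancedTerm_le_T (n : ℕ) :
    ∑ j ∈ Finset.Icc 1 n, balancedTerm d j ≤ 49 / 24 * (1 / 2 : ℝ) ^ (d / 2) := by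
  have h1 := factorial_div_pow_le_half_pow (d := d) (by omega)
  have h2 := (balancedTerm_two_le_factorial_div (d := d) (by omega)).trans h1
  have h3 := tailBound₂_le (d := d) (s := (1 / 2 : ℝ) ^ (d / 2)) (by positivity)
    (stirling_test_half_pow (by omega))
  have h4 := sum_balancedTerm_le₂ (d := d) (by omega) n
  linarith

/-- `T ≤ 0.26/d³`. [cite: BockEtAl2020, §4 (proof of Cor 1.5, (4.11)–(4.13))] -/
theorem T_le : 49 / 24 * (1 / 2 : ℝ) ^ (d / 2) ≤ 0.26 * (1 / (d : ℝ) ^ 3) := by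
  have hD0 := D_pos hd
  have h := half_pow_le hd
  have e : (1 : ℝ) / (8 * (d : ℝ) ^ 3) = (1 / 8) * (1 / (d : ℝ) ^ 3) := by
    rw [one_div_mul_one_div]
  rw [e] at h
  have h3 : 0 ≤ 1 / (d : ℝ) ^ 3 := by positivity
  nlinarith

/-- The inverse `(1 - p̂)⁻¹` for `p̂ = 1/d + 2/d²`: between `1` and `1 + 1.08/d`. [cite: BockEtAl2020, §4 (proof of Cor 1.5, (4.11)–(4.13))] -/
theorem inv_one_sub_p_bounds :
    1 ≤ (1 - (1 / (d : ℝ) + 2 * (1 / (d : ℝ) ^ 2)))⁻¹ ∧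
      (1 - (1 / (d : ℝ) + 2 * (1 / (d : ℝ) ^ 2)))⁻¹ ≤ 1 + 1.08 * (1 / (d : ℝ)) := by
  have hD := D_ge hd
  have hD0 := D_pos hd
  have hq : (0 : ℝ) < (d : ℝ) ^ 2 - d - 2 := by nlinarith
  have e : 1 - (1 / (d : ℝ) + 2 * (1 / (d : ℝ) ^ 2)) = ((d : ℝ) ^ 2 - d - 2) / (d : ℝ) ^ 2 := by
    field_simp
    ring
  rw [e, inv_div]
  constructor
  · rw [le_div_iff₀ hq]
    linarith
  · rw [div_le_iff₀ hq]
    have e2 : (1 + 1.08 * (1 / (d : ℝ))) * ((d : ℝ) ^ 2 - d - 2)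
        = (d : ℝ) ^ 2 + 0.08 * d - 3.08 - 2.16 * (1 / d) := by
      field_simp
      ring
    rw [e2]
    have h1 : 1 / (d : ℝ) ≤ 1 / 40 := one_div_le_one_div_of_le (by norm_num) hD
    nlinarith

/-- `((1 - p̂)⁻¹)^(2d-1) ≤ 9`. [cite: BockEtAl2020, §4 (proof of Cor 1.5, (4.11)–(4.13))] -/
theorem inv_one_sub_p_pow_le :
    (1 - (1 / (d : ℝ) + 2 * (1 / (d : ℝ) ^ 2)))⁻¹ ^ (2 * d - 1) ≤ 9 := by
  have hD := D_ge hd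
  have hD0 := D_pos hd
  obtain ⟨hX1, hXU⟩ := inv_one_sub_p_bounds hd
  generalize (1 - (1 / (d : ℝ) + 2 * (1 / (d : ℝ) ^ 2)))⁻¹ = X at hX1 hXU ⊢
  have hX0 : 0 ≤ X := by linarith
  have hexp : X ≤ Real.exp (X - 1) := by linarith [Real.add_one_le_exp (X - 1)]
  have harg : ((2 * d : ℕ) : ℝ) * (X - 1) ≤ 2.16 := by
    have h1 : X - 1 ≤ 1.08 * (1 / (d : ℝ)) := by linarith
    calc ((2 * d : ℕ) : ℝ) * (X - 1) ≤ (2 * (d : ℝ)) * (1.08 * (1 / (d : ℝ))) := by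
          push_cast
          exact mul_le_mul_of_nonneg_left h1 (by positivity)
      _ = 2.16 := by field_simp; ring
  calc X ^ (2 * d - 1) ≤ X ^ (2 * d) := pow_le_pow_right₀ hX1 (by omega)
    _ ≤ Real.exp (X - 1) ^ (2 * d) := pow_le_pow_left₀ hX0 hexp _
    _ = Real.exp (((2 * d : ℕ) : ℝ) * (X - 1)) := (Real.exp_nat_mul _ _).symm
    _ ≤ Real.exp 2.16 := Real.exp_le_exp.2 harg
    _ ≤ 9 := exp_216_le

-- buildfix 2026-08-20 (class ii): `lake build` hits the 200000-heartbeat cliff at the closing `exact`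
-- (:542; farm elaboration passes) — scoped budget, as for BUILD-BROKEN rows 2-1/2-2.
set_option maxHeartbeats 400000 in
/-- **BDNS Cor. 1.5, first inequality, for every `d ≥ 40`**, by road (i) of the module docstring:
uniform-in-`d` witnesses for `criticalProb_lt_pShield_of_numerics`. [cite: BockEtAl2020, §4 (proof of Cor 1.5, (4.11)–(4.13))] -/
theorem criticalProb_lt_pShield_of_forty_le' : criticalProb (zdGraph d) 0 < pShield d := by
  have hD := D_ge hd
  have hD0 := D_pos hd
  -- the witnesses, as opaque reals with defining equations
  obtain ⟨T, hTdef⟩ : ∃ T : ℝ, T = 49 / 24 * (1 / 2 : ℝ) ^ (d / 2) := ⟨_, rfl⟩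
  obtain ⟨p, hpdef⟩ : ∃ p : ℝ, p = 1 / (d : ℝ) + 2 * (1 / (d : ℝ) ^ 2) := ⟨_, rfl⟩
  obtain ⟨g, hgdef⟩ : ∃ g : ℝ, g = rhoHead d + rhoMid d + T := ⟨_, rfl⟩
  obtain ⟨ρ, hρdef⟩ : ∃ ρ : ℝ, ρ = retHead d + retMid d + d * T := ⟨_, rfl⟩
  obtain ⟨r, hrdef⟩ : ∃ r : ℝ, r = 1 - (1 - ρ) / ((d : ℝ) ^ 2 * ρ - d) - 1 / (d : ℝ) ^ 2 :=
    ⟨_, rfl⟩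
  -- elementary bounds
  have hT0 : 0 ≤ T := by rw [hTdef]; positivity
  have hTle : T ≤ 0.26 * (1 / (d : ℝ) ^ 3) := by rw [hTdef]; exact T_le hd
  have hi40 : 1 / (d : ℝ) ≤ 1 / 40 := one_div_le_one_div_of_le (by norm_num) hD
  have hi2 : 1 / (d : ℝ) ^ 2 ≤ 1 / 1600 := by
    apply one_div_le_one_div_of_le (by norm_num); nlinarith
  have hi3 : 1 / (d : ℝ) ^ 3 ≤ 1 / 64000 := by
    apply one_div_le_one_div_of_le (by norm_num); nlinarith
  have hi30 : 0 < 1 / (d : ℝ) ^ 3 := by positivity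
  have hi20 : 0 < 1 / (d : ℝ) ^ 2 := by positivity
  have hi32 : 1 / (d : ℝ) ^ 3 ≤ 1 / 40 * (1 / (d : ℝ) ^ 2) := by
    rw [pow_succ, ← one_div_mul_one_div, mul_comm]
    exact mul_le_mul_of_nonneg_right hi40 hi20.le
  -- `g < p < 1`
  have hg : g ≤ 1 / (d : ℝ) + 1.355 * (1 / (d : ℝ) ^ 3) := by
    have := rhoHead_le hd; have := rhoMid_le' hd; rw [hgdef]; linarith
  have hgp : g < p := by rw [hpdef]; nlinarith
  have hp1 : p < 1 := by rw [hpdef]; linarith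
  -- `ρ`
  have hDT : (d : ℝ) * T ≤ 0.26 * (1 / (d : ℝ) ^ 2) := by
    have e : (d : ℝ) * (0.26 * (1 / (d : ℝ) ^ 3)) = 0.26 * (1 / (d : ℝ) ^ 2) := by
      field_simp
    rw [← e]
    exact mul_le_mul_of_nonneg_left hTle hD0.le
  have hρU : ρ ≤ 1 / (d : ℝ) + 1.26 * (1 / (d : ℝ) ^ 2) + 3.49 * (1 / (d : ℝ) ^ 3) := by
    have := retHead_le hd; have := retMid_le' hd; rw [hρdef]; linarith
  have hρL : 1 / (d : ℝ) + 0.975 * (1 / (d : ℝ) ^ 2) ≤ ρ := by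
    have := retHead_ge hd; have := retMid_nonneg d
    have : 0 ≤ (d : ℝ) * T := by positivity
    rw [hρdef]; linarith
  have hρd : 1 / (d : ℝ) < ρ := by nlinarith
  have hρ03 : ρ ≤ 0.03 := by linarith
  have hρ1 : ρ < 1 := by linarith
  -- the renewal denominator
  have hden_ge : 0.975 ≤ (d : ℝ) ^ 2 * ρ - d := by
    have h1 : (d : ℝ) ^ 2 * (1 / (d : ℝ) + 0.975 * (1 / (d : ℝ) ^ 2)) = d + 0.975 := by
      field_simp
    have h2 := mul_le_mul_of_nonneg_left hρL (by positivity : (0 : ℝ) ≤ (d : ℝ) ^ 2)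
    rw [h1] at h2
    linarith
  have hden_le : (d : ℝ) ^ 2 * ρ - d ≤ 1.35 := by
    have h1 : (d : ℝ) ^ 2 * (1 / (d : ℝ) + 1.26 * (1 / (d : ℝ) ^ 2) + 3.49 * (1 / (d : ℝ) ^ 3))
        = d + 1.26 + 3.49 * (1 / d) := by
      field_simp
    have h2 := mul_le_mul_of_nonneg_left hρU (by positivity : (0 : ℝ) ≤ (d : ℝ) ^ 2)
    rw [h1] at h2
    linarith
  have hden_pos : 0 < (d : ℝ) ^ 2 * ρ - d := by linarith
  have hfrac : 0.97 / 1.35 ≤ (1 - ρ) / ((d : ℝ) ^ 2 * ρ - d) :=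
    div_le_div₀ (by linarith) (by linarith) hden_pos hden_le
  have hrU : r ≤ 0.29 := by
    rw [hrdef]
    have : (0.71 : ℝ) ≤ 0.97 / 1.35 := by norm_num
    linarith [hi20.le]
  -- the inverse `(1 - p)⁻¹` and its power
  have hXb := inv_one_sub_p_bounds hd
  rw [← hpdef] at hXb
  obtain ⟨hX1, hXU⟩ := hXb
  have hXU' : (1 - p)⁻¹ ≤ 1.03 := by linarith
  have hY : (1 - p)⁻¹ ^ (2 * d - 1) ≤ 9 := by rw [hpdef]; exact inv_one_sub_p_pow_le hd
  have hY1 : 1 ≤ (1 - p)⁻¹ ^ (2 * d - 1) := one_le_pow₀ hX1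
  -- the two renewal inequalities with `VS = 2`, `V0 = 4`
  have hβ : 1 ≤ (1 - p)⁻¹ * 2 := by linarith
  have hα : 1 ≤ (1 - p)⁻¹ ^ (2 * d - 1) * 4 := by linarith
  have h0cond : 1 + (1 - 1 / d) * ((1 - p)⁻¹ * 2 - 1) +
      (1 / d) * ((1 - p)⁻¹ ^ (2 * d - 1) * 4 - 1) ≤ 4 := by
    have e1 : (1 - 1 / (d : ℝ)) * ((1 - p)⁻¹ * 2 - 1) ≤ 1 * ((1 - p)⁻¹ * 2 - 1) :=
      mul_le_mul_of_nonneg_right (by linarith [show 0 ≤ 1 / (d : ℝ) by positivity])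
        (by linarith)
    have e2 : (1 / (d : ℝ)) * ((1 - p)⁻¹ ^ (2 * d - 1) * 4 - 1) ≤ (1 / 40) * 35 :=
      mul_le_mul hi40 (by linarith) (by linarith) (by norm_num)
    linarith
  have hScond : 1 + r * ((1 - p)⁻¹ * 2 - 1) +
      (1 / (d : ℝ) ^ 2) * ((1 - p)⁻¹ ^ (2 * d - 1) * 4 - 1) ≤ 2 := by
    have e1 : r * ((1 - p)⁻¹ * 2 - 1) ≤ 0.29 * ((1 - p)⁻¹ * 2 - 1) :=
      mul_le_mul_of_nonneg_right hrU (by linarith)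
    have e2 : (1 / (d : ℝ) ^ 2) * ((1 - p)⁻¹ ^ (2 * d - 1) * 4 - 1) ≤ (1 / 1600) * 35 :=
      mul_le_mul hi2 (by linarith) (by linarith) (by norm_num)
    linarith
  exact criticalProb_lt_pShield_of_numerics (d := d) (by omega) (T := T) (g := g) (p := p) (ρ := ρ)
    (r := r) (VS := 2) (V0 := 4) (fun n => hTdef ▸ sum_balancedTerm_le_T hd n)
    (le_of_eq hgdef.symm) hgp hp1 (le_of_eq hρdef.symm) hρd hρ1 (le_of_eq hrdef.symm)
    (by norm_num) hβ hα h0cond hScond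

end Forty

end BDNSLargeD


/-- **Discharge of the large-`d` child**: `p_c(d) < p_shield(d)` for every `d ≥ 40`.
[cite: BockEtAl2020, Cor 1.5 and §4 (proof: (4.11)–(4.13))] -/
theorem BockEtAl2020_criticalProb_lt_pShield_of_forty_le_holds :
    BockEtAl2020_criticalProb_lt_pShield_of_forty_le :=
  fun _ hd => BDNSLargeD.criticalProb_lt_pShield_of_forty_le' hd

/-- **BDNS Corollary 1.5 for every `d ≥ 10`**, unconditionally: `p_c(d) < p_shield(d) ≤ p_fin(d)`
(the named fact `BockEtAl2020_Cor_1_5` of `FiniteClustersPercolation.lean` is DISCHARGED).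
[cite: BockEtAl2020, Cor 1.5] -/
theorem BockEtAl2020_Cor_1_5_holds : BockEtAl2020_Cor_1_5 :=
  BockEtAl2020_Cor_1_5_holds_of BockEtAl2020_criticalProb_lt_pShield_of_forty_le_holds

end Literature.Probability.Percolation

end
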